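import Summits.Ventures.HodgeRepro2.T6N3HypL2Aut
import Summits.Ventures.HodgeRepro2.T6N42Toy

/-!
# T6N3L2AutToy — non-vacuity of the shared «`π₀^∞` admissible irreducible» display (README §10.5(ii)(c)/(d)): a toy `L2AutShape` on which `Hyp.GetzHahn2024_Thm6_5_2` holds (proof lane)

Cell pub-hodge-repro2, Tier 6 (README §10), seat t6-p3 (N3 owner, M2). Filed in WAVE 1 (the opener
INBOX l. 97 / STATUS l. 12740; TARGET-T6.md v1.5 §11.0 decision (6)). The toy: `L²([G]) = ℂ`, `π₀ = ⊤`, the finite part = one place, trivial groups, `W = ℂ`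
with the trivial action (admissible by `N42Toy.trivial_smooth` + finite-dimensional invariants,
irreducible by `N42Toy.trivial_irreducible`); both predicate fields `True`. On it the display holds
outright and its conclusion is t6-p5's `FactorizationShape.AdmissibleIrreducible`. The toy finite
part `toyS` agrees with t6-p5's `N42Flath.toyShape` (T6N42FlathToy) in `Place / G / GA / W / ρ` but
NOT in `Factorizable` (`toyS`: every family; `toyShape`: the families of admissible irreducible
components) — so `toyT` instantiates Thm 6.5.2 ALONE; the JOINT instantiation of the three displays
(Thm 6.5.2 + Thm 5.7.1 + the §5.7 note; README §10.5(ii)(d)) is t6-p5's `toyL2AutShape` on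
`toyShape` (T6N42RichHostDisp), not this file: on `toyS` the §5.7-note display would be false (every
family, reducible ones included, would be declared admissible irreducible). This sentence corrects
the v1 docstring («… instantiate on ONE finite part»), t6-p5's finding STATUS l. 12871 (iii); the
declarations are byte-identical to v1 (p439755).
v3 = a DOCSTRING-ONLY successor version (kernel content unchanged; count NONE; filed under the PARK
release clause STATUS l. 12943 in the lead's CLASS reading l. 13037 (1) — the in-body stale-tag class
of t6-p6's l. 13057; v1 p439755 = the banded bytes of record, v2 = p448287): the in-body tag
«t6-p5's staged `N42Flath.trivial_isAdmissible`» in the docstring of `trivialRep_isAdmissible` is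
dropped — that theorem was filed by t6-p5 in WAVE 1 as T6N42FlathToy (p438326, 2026-08-26T10:33Z;
v2 p455182); the restatement here stands (this file imports T6N42Toy, not T6N42FlathToy).

§8(d): uses an L-value-free non-vanishing device: NO.
-/

namespace Summit.Ventures.HodgeRepro2.T6.N3L2Aut

open Summit.Ventures.HodgeRepro2
open Summit.Ventures.HodgeRepro2.T6.N42Flath
open Summit.Ventures.HodgeRepro2.T6.N42Toy

/-- The toy finite part: one place, trivial groups, `W = ℂ` with the trivial action of the trivial
group, «factorizable» through every family. -/
def toyS : FactorizationShape where
  Place := Unit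
  G := fun _ => Unit
  GA := Unit
  W := ℂ
  ρ := Representation.trivial ℂ Unit ℂ
  Factorizable := fun _ => True

/-- The trivial representation of the trivial group on `ℂ` is admissible: smooth
(`N42Toy.trivial_smooth`), and its invariants under any subgroup are a submodule of the
finite-dimensional `ℂ` (the statement of t6-p5's `N42Flath.trivial_isAdmissible` — T6N42FlathToy,
filed in WAVE 1 as p438326, staged when this file was written — restated here so that this file
does not import T6N42FlathToy). -/
theorem trivialRep_isAdmissible : IsAdmissible (Representation.trivial ℂ Unit ℂ) :=
  ⟨trivial_smooth, fun _ _ _ => inferInstance⟩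

/-- The toy finite part is admissible and irreducible. -/
theorem toyS_admissibleIrreducible : toyS.AdmissibleIrreducible :=
  ⟨trivialRep_isAdmissible, trivial_irreducible⟩

/-- The toy shape: `L²([G]) = ℂ`, `π₀ = ⊤`, the finite part `toyS`, both printed notions `True`. -/
noncomputable def toyT : L2AutShape where
  S := toyS
  L2 := ℂ
  π₀ := ⊤
  IsL2Aut := fun _ => True
  IsFinitePart := fun _ => True

/-- The display holds on the toy. -/
theorem toyT_thm6_5_2 : Hyp.GetzHahn2024_Thm6_5_2 toyT :=
  fun _ _ => toyS_admissibleIrreducible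

/-- The display is not closed by its hypotheses alone: on the toy both hypotheses are `True` and the
conclusion is the (non-trivial) admissibility + irreducibility of `toyS.ρ`. -/
theorem toyT_hyps : toyT.IsL2Aut toyT.π₀ ∧ toyT.IsFinitePart toyT.π₀ :=
  ⟨trivial, trivial⟩

end Summit.Ventures.HodgeRepro2.T6.N3L2Aut
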